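import Literature.IUT.LogVolume.Corollary22Legendre
import Literature.IUT.LogVolume.Corollary22TateInput
import Literature.IUT.LogVolume.Corollary22PartI
import Literature.NumberTheory.DiophantineGeometry.GenEllLCyclicHeightBound
import Literature.NumberTheory.DiophantineGeometry.GenEllImageModLContainsSL2
import Literature.NumberTheory.DiophantineGeometry.GenEllMellReduction
import Literature.NumberTheory.EllipticCurves.HeightsBaseChangeProofs
import Mathlib.NumberTheory.RamificationInertia.Valuation
import Mathlib.NumberTheory.RamificationInertia.Galois
import Mathlib.FieldTheory.Galois.IsGaloisGroup
import HarnessLib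

/-!
# [IUTchIV] Corollary 2.2 (ii), proof: the Galois-image input (P4) ⇒ (P6) — DISCHARGE of
# `Cor22.FullGaloisImage`

Mochizuki, *Inter-universal Teichmüller theory IV*, RIMS manuscript (Apr. 2020; = PRIMS **57** (2021)),
proof of Cor. 2.2 (ii), pp. 45–46: "(P4) `E_F` does not admit an `l`-cyclic subgroup scheme. Indeed, the
existence of an `l`-cyclic subgroup scheme of `E_F` would imply that … `log(q^∀)` is bounded [(i), (P2),
[GenEll] Lem. 3.5, Prop. 3.4]" and "(P6) the image of the outer homomorphism `Gal(ℚ̄/F) → GL₂(𝔽_l)` …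
contains the subgroup `SL₂(𝔽_l)` … Indeed, since, by (P5), `E_F` has bad multiplicative reduction at
some valuation ∈ `𝕍^bad_mod ≠ ∅`, (P6) follows formally from (P2), (P4), and [GenEll], Lemma 3.1, (iii)".
PROOF-ONLY file (no definitions); CLASSICAL content (no Θ-data occur); TAKES NO SIDE on [IUTchIII]
Cor. 3.12. It proves the named interface `Cor22.FullGaloisImage` of `Corollary22Legendre.lean`
(`fullGaloisImage_holds`) by transporting the point `λ ∈ K_V ∩ U_X(F_tpd)` to the presented curve
`E_F` over a theta-field `F = F_tpd(√−1, E[3·5])` (`Cor22.thetaEllPoint`) and applying the tree's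
[GenEll] §3 theorems: the (P4) exclusion in `EllPoint` form (`exists_htInf_le_of_admitsLCyclic`,
`GenEllLCyclicHeightBound.lean`, from [GenEll] Lem. 3.5 + Prop. 3.4) and the (P2)+(P4) ⇒ (P6) glue with
the Tate-curve transvection (`imageModLContainsSL2_of_not_admitsLCyclic_of_hasMultiplicativeReductionAt`,
`GenEllImageModLContainsSL2.lean`; `Corollary22TateInput.lean`). The transport: `j(E_F) = j(λ)` in `F`;
`|σ(j(E_F))| ≤ R(K_∞)` for every `σ : F → ℂ` ((i): `j` is bounded on the compact `K_∞`); `ht_∞(E_F) =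
ht_∞(λ)` (`h_F = [F:F_tpd]·h_{F_tpd}`); the local heights of `E_F` are `e(w|v)·h_v(λ)` with `e(w|v) ∣
[F:F_tpd] ∣ 2^{10}·3^2·5` (`F/F_tpd` Galois), so that for `l ≥ 7` condition (P2) over `F_tpd` gives
"`l` prime to the local heights of `E_F`"; and the (P5) place of `F_tpd` lifts to a place of `F` of
multiplicative reduction not dividing `l` (semistability of `E_F`).
-/

noncomputable section

namespace Literature.IUT.LogVolume

namespace Cor22

open NumberField IsDedekindDomain Literature.NumberTheory.DiophantineGeometry.GenEll
open Literature.NumberTheory.DiophantineGeometry Real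

section ThetaField

variable {P : NFPoint} (F : Type) [Field F] [NumberField F] [Algebra P.F F]

/-- `j(E_F) = j(λ)` (in `F`): the `j`-invariant of the Legendre curve over the theta-field is the image of
`j(λ) = 2^8(λ²−λ+1)³/(λ²(λ−1)²)`. [claim: Mochizuki2012, status: disputed] -/
theorem thetaEllPoint_j (hU : P.InU) : (thetaEllPoint P hU F).W.j = algebraMap P.F F (jInv P.x) := by
  haveI : (⟨0, -(1 + (extend P F).x), 0, (extend P F).x, 0⟩ :
      WeierstrassCurve (extend P F).F).IsElliptic := thetaCurve_isElliptic hU F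
  have h := j_legendre (extend P F) (extend_inU hU F)
  rw [map_jInv]
  exact h

/-- `ht_∞(E_F) = ht_∞(λ)`: the normalized height of `j` does not change under the extension `F/F_tpd`
(`h_F(j) = [F:F_tpd]·h_{F_tpd}(j)`, the tree's `logHeight₁_algebraMap`). [claim: Mochizuki2012, status: disputed] -/
theorem thetaEllPoint_htInf (hU : P.InU) : (thetaEllPoint P hU F).htInf = htInfty P := by
  have hj := thetaEllPoint_j F hU
  unfold EllPoint.htInf EllPoint.degree htInfty NFPoint.degree
  unfold thetaEllPoint at hj ⊢
  dsimp only at hj ⊢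
  rw [hj, NumberField.logHeight₁_algebraMap]
  have htower : (Module.finrank ℚ F : ℝ) = Module.finrank ℚ P.F * Module.finrank P.F F := by
    rw [← Module.finrank_mul_finrank ℚ P.F F, Nat.cast_mul]
  have h1 : (0 : ℝ) < Module.finrank ℚ P.F := Nat.cast_pos.mpr Module.finrank_pos
  have h2 : (0 : ℝ) < Module.finrank P.F F := Nat.cast_pos.mpr Module.finrank_pos
  rw [htower]
  field_simp

/-- On `K_V`: every complex conjugate of `j(E_F)` is bounded by the bound `R` of `|j|` on `K_∞` ((i): `j` is
continuous on the compact `K_∞ ⊆ ℂ ∖ {0,1}`, the tree's `exists_jInv_bound`). [claim: Mochizuki2012, status: disputed] -/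
theorem thetaEllPoint_norm_le (hU : P.InU) {D : CBData} (hP : D.Mem P) {R : ℝ} (hR : ∀ z ∈ D.Karc, ‖jInv z‖ ≤ R)
    (σ : F →+* ℂ) : ‖σ (thetaEllPoint P hU F).W.j‖ ≤ R := by
  rw [thetaEllPoint_j]
  have : σ (algebraMap P.F F (jInv P.x)) = jInv ((σ.comp (algebraMap P.F F)) P.x) := by
    simp only [RingHom.comp_apply, map_jInv]
  rw [this]
  exact hR _ (hP.1 _)

/-- Valuations in the tower `F/F_tpd`: `ord_w(x) = e(w|v)·ord_v(x)` for `x ∈ F_tpd` and `w ∣ v` (prolongation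
of a discrete valuation with ramification index `e`; Mathlib's `valuation_liesOver`).
[cite: SerreLocalFields1979, Ch. I §4] -/
theorem ord_algebraMap_of_liesOver (v : HeightOneSpectrum (𝓞 P.F)) (w : HeightOneSpectrum (𝓞 F))
    [w.asIdeal.LiesOver v.asIdeal] (x : P.F) :
    ord F w (algebraMap P.F F x) = (v.asIdeal.ramificationIdx' w.asIdeal : ℤ) * ord P.F v x := by
  unfold ord
  rw [← IsDedekindDomain.HeightOneSpectrum.valuation_liesOver F v w x, WithZero.log_pow]
  ring

/-- In the Galois extension `F/F_tpd` the ramification index `e(w|v)` divides `[F:F_tpd]`: for a Galois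
extension the ramification indices over a given prime coincide and `g·e·f = [F:F_tpd]` (Mathlib's
`ncard_primesOver_mul_ramificationIdxIn_mul_inertiaDegIn`). [cite: SerreLocalFields1979, Ch. I §7 Prop. 19 and Cor.] -/
theorem ramificationIdx'_dvd_finrank [IsGalois P.F F] (v : HeightOneSpectrum (𝓞 P.F))
    (w : HeightOneSpectrum (𝓞 F)) [w.asIdeal.LiesOver v.asIdeal] :
    v.asIdeal.ramificationIdx' w.asIdeal ∣ Module.finrank P.F F := by
  haveI := w.isPrime
  haveI := v.isPrime
  rw [Ideal.ramificationIdx'_eq_ramificationIdx (p := v.asIdeal) (q := w.asIdeal) v.ne_bot]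
  have h := Ideal.ncard_primesOver_mul_ramificationIdxIn_mul_inertiaDegIn v.asIdeal (𝓞 F) Gal(F/P.F)
  rw [Ideal.ramificationIdxIn_eq_ramificationIdx v.asIdeal w.asIdeal Gal(F/P.F),
    IsGaloisGroup.card_eq_finrank Gal(F/P.F) P.F F] at h
  exact ⟨(v.asIdeal.primesOver (𝓞 F)).ncard * v.asIdeal.inertiaDegIn (𝓞 F), by rw [← h]; ring⟩

/-- A prime `l ≥ 7` does not divide `46080 = 2^{10}·3^2·5`. [folklore] -/
private theorem not_dvd_46080 {l : ℕ} (hl : l.Prime) (hl7 : 7 ≤ l) : ¬ l ∣ 46080 := by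
  intro h
  have h' : l ∣ 2 ^ 10 * 3 ^ 2 * 5 := by norm_num; exact h
  rcases (Nat.Prime.dvd_mul hl).mp h' with h23 | h5
  · rcases (Nat.Prime.dvd_mul hl).mp h23 with h2 | h3
    · have := Nat.le_of_dvd (by norm_num) (Nat.Prime.dvd_of_dvd_pow hl h2); omega
    · have := Nat.le_of_dvd (by norm_num) (Nat.Prime.dvd_of_dvd_pow hl h3); omega
  · have := Nat.le_of_dvd (by norm_num) h5; omega

/-- **The local heights of `E_F`**: at a place `w` of `F` over the place `v` of `F_tpd`, `h_w(E_F) =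
−ord_w(j(E_F)) = e(w|v)·(−ord_v(j(λ)))` ([GenEll] Rmk. 3.3.1: local heights scale by the ramification
index). [claim: Mochizuki2012, status: disputed] -/
theorem thetaEllPoint_localHeight (hU : P.InU) (v : HeightOneSpectrum (𝓞 P.F)) (w : HeightOneSpectrum (𝓞 F))
    [w.asIdeal.LiesOver v.asIdeal] :
    (thetaEllPoint P hU F).localHeight w =
      (v.asIdeal.ramificationIdx' w.asIdeal : ℤ) * (-(ord P.F v (jInv P.x))) := by
  have hj := thetaEllPoint_j F hU
  unfold EllPoint.localHeight
  unfold thetaEllPoint at hj ⊢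
  dsimp only at hj ⊢
  rw [hj, ord_algebraMap_of_liesOver F v w]
  ring

/-- **(P2) over `F_tpd` gives "`l` prime to the local heights of `E_F`" for `l ≥ 7`** (p. 45 (P2): "`l` does
not divide any nonzero `h_v`"): at a place `w` of `F` of multiplicative reduction, `h_w = e(w|v)·h_v(λ)` with
`h_v(λ) = −ord_v(j(λ)) > 0`, `l ∤ h_v(λ)` by (P2), and `l ∤ e(w|v)` since `e(w|v) ∣ [F:F_tpd] ∣ 2^{10}·3^2·5`.
[claim: Mochizuki2012, status: disputed] -/
theorem not_dvd_localHeight_thetaEllPoint (hU : P.InU) (hF : IsThetaField P F) {l : ℕ} (hl : l.Prime) (hl7 : 7 ≤ l)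
    (hP2 : CondP2 P l) (w : HeightOneSpectrum (𝓞 F))
    (hw : (thetaCurve P F).HasMultiplicativeReductionAt w) :
    ¬ ((l : ℤ) ∣ (thetaEllPoint P hU F).localHeight w) := by
  haveI := w.isPrime
  let v : HeightOneSpectrum (𝓞 P.F) :=
    ⟨w.asIdeal.under (𝓞 P.F), inferInstance, Ideal.under_ne_bot (𝓞 P.F) w.ne_bot⟩
  haveI : w.asIdeal.LiesOver v.asIdeal := ⟨rfl⟩
  haveI := hF.isGalois
  have hloc := thetaEllPoint_localHeight F hU v w
  have hpos : 0 < (thetaEllPoint P hU F).localHeight w :=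
    (thetaEllPoint P hU F).localHeight_pos_of_hasMultiplicativeReductionAt w hw
  have he0 : v.asIdeal.ramificationIdx' w.asIdeal ≠ 0 :=
    Ideal.IsDedekindDomain.ramificationIdx'_ne_zero_of_liesOver w.asIdeal v.ne_bot
  have hordneg : ord P.F v (jInv P.x) < 0 := by
    rw [hloc] at hpos
    by_contra hge
    rw [not_lt] at hge
    have : (v.asIdeal.ramificationIdx' w.asIdeal : ℤ) * (-(ord P.F v (jInv P.x))) ≤ 0 :=
      mul_nonpos_of_nonneg_of_nonpos (by positivity) (by linarith)
    linarith
  have h1 : ¬ ((l : ℤ) ∣ ord P.F v (jInv P.x)) := hP2 v hordneg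
  have hedvd : v.asIdeal.ramificationIdx' w.asIdeal ∣ 46080 :=
    (ramificationIdx'_dvd_finrank F v w).trans hF.finrank_dvd
  have h2 : ¬ (l ∣ v.asIdeal.ramificationIdx' w.asIdeal) := fun h => not_dvd_46080 hl hl7 (h.trans hedvd)
  rw [hloc]
  intro hdvd
  have hprime : Prime (l : ℤ) := Nat.prime_iff_prime_int.mp hl
  rcases hprime.dvd_or_dvd hdvd with h | h
  · exact h2 (Int.natCast_dvd_natCast.mp h)
  · exact h1 (dvd_neg.mp h)

/-- **The (P5) place over `F`** (p. 46: "since, by (P5), `E_F` has bad multiplicative reduction at some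
valuation ∈ `𝕍^bad_mod ≠ ∅`"): a place `v ∤ 2l` of `F_tpd` with `ord_v(j(λ)) < 0` has above it a place `w`
of `F` of MULTIPLICATIVE reduction (`E_F` is semistable and `h_w > 0`) with `w ∤ l` and `l ∤ h_w =
ord_w(Δ_min)`. [claim: Mochizuki2012, status: disputed] -/
theorem exists_multiplicative_place_thetaEllPoint (hU : P.InU) (hF : IsThetaField P F) {l : ℕ} (hl : l.Prime)
    (hl7 : 7 ≤ l) (hP2 : CondP2 P l) (hP5 : CondP5 P l) :
    ∃ w : HeightOneSpectrum (𝓞 F), (thetaCurve P F).HasMultiplicativeReductionAt w ∧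
      (l : 𝓞 F) ∉ w.asIdeal ∧ ¬ l ∣ (thetaCurve P F).ordMinimalDiscriminant w := by
  obtain ⟨v, hv, -, hvl⟩ := hP5
  haveI := v.isPrime
  obtain ⟨⟨W, hWp, hWo⟩⟩ := v.asIdeal.nonempty_primesOver (S := 𝓞 F)
  haveI := hWp
  haveI := hWo
  have hWne : W ≠ ⊥ := Ideal.ne_bot_of_liesOver_of_ne_bot v.ne_bot W
  let w : HeightOneSpectrum (𝓞 F) := ⟨W, hWp, hWne⟩
  haveI : w.asIdeal.LiesOver v.asIdeal := hWo
  have hloc := thetaEllPoint_localHeight F hU v w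
  have he0 : v.asIdeal.ramificationIdx' w.asIdeal ≠ 0 :=
    Ideal.IsDedekindDomain.ramificationIdx'_ne_zero_of_liesOver w.asIdeal v.ne_bot
  have hpos : 0 < (thetaEllPoint P hU F).localHeight w := by
    rw [hloc]
    apply mul_pos
    · exact_mod_cast Nat.pos_of_ne_zero he0
    · linarith
  have hmult : (thetaCurve P F).HasMultiplicativeReductionAt w := by
    rcases hF.isSemistable w with hgood | hm
    · exact absurd ((thetaEllPoint P hU F).localHeight_nonpos_of_hasGoodReductionAt w hgood)
        (not_le.mpr hpos)
    · exact hm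
  refine ⟨w, hmult, ?_, ?_⟩
  · intro hmem
    apply hvl
    have h1 : algebraMap (𝓞 P.F) (𝓞 F) (l : 𝓞 P.F) ∈ w.asIdeal := by rwa [map_natCast]
    have h2 : (l : 𝓞 P.F) ∈ w.asIdeal.under (𝓞 P.F) := Ideal.mem_comap.mpr h1
    rwa [← hWo.over] at h2
  · intro h
    have key := (thetaEllPoint P hU F).natCast_dvd_localHeight_iff hmult l
    exact not_dvd_localHeight_thetaEllPoint F hU hF hl hl7 hP2 w hmult (key.mpr h)

end ThetaField

/-! ## The discharge -/

/-- **`Cor22.FullGaloisImage` HOLDS** — the classical Galois-image input (P4) ⇒ (P6) of the proof of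
[IUTchIV] Cor. 2.2 (ii) (pp. 45–46), PROVED: for `K_V` with the hypotheses of Cor. 2.2, with `H_K := ` the
bound of [GenEll] Lem. 3.5 + Prop. 3.4 for the curves whose `j`-conjugates are bounded by the bound of `|j|`
on `K_∞` (`exists_htInf_le_of_admitsLCyclic`), every `λ ∈ K_V ∩ U_X`, prime `l ≥ 7` with (P2), (P5) and
`log(q^∀(λ)) > H_K` satisfies (P6): an `l`-cyclic subgroup scheme of `E_F` would force `log(q^∀(λ)) ≤
ht_∞(λ) = ht_∞(E_F) ≤ H_K` ((P4)); and then the multiplicative place over the (P5) place, with `l ∤ h_w`,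
gives `SL₂(𝔽_l) ⊆` image by the Tate transvection and [GenEll] Lem. 3.1 (iii)
(`imageModLContainsSL2_of_not_admitsLCyclic_of_hasMultiplicativeReductionAt`). No Θ-data occur; no side is
taken on [IUTchIII] Cor. 3.12. [claim: Mochizuki2012, status: disputed] -/
theorem fullGaloisImage_holds : FullGaloisImage := by
  intro D hD
  obtain ⟨R, hR⟩ := exists_jInv_bound D
  obtain ⟨B, hB⟩ := exists_htInf_le_of_admitsLCyclic R
  refine ⟨B, ?_⟩
  intro P hPD hUP l hl hl7 hP2 hP5 hh hU F _ _ _ hF _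
  haveI : Fact l.Prime := ⟨hl⟩
  have hno : ¬ (thetaEllPoint P hU F).AdmitsLCyclic l := by
    intro hcyc
    have h1 := hB (thetaEllPoint P hU F) l hl hF.isSemistable (thetaEllPoint_norm_le F hU hPD hR)
      (fun w hw => not_dvd_localHeight_thetaEllPoint F hU hF hl hl7 hP2 w hw) hcyc
    rw [thetaEllPoint_htInf] at h1
    have h2 := logQForall_le_htInfty P
    linarith
  obtain ⟨w, hmult, hwl, hnd⟩ := exists_multiplicative_place_thetaEllPoint F hU hF hl hl7 hP2 hP5
  exact (thetaEllPoint P hU F).imageModLContainsSL2_of_not_admitsLCyclic_of_hasMultiplicativeReductionAt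
    l hno hmult hwl hnd

end Cor22

end Literature.IUT.LogVolume

end
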